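import Summits.ABC.ABC.Theses.IsogenyGlueCongruence
import Summits.ABC.ABC.Theorems.EllipticGluingPrimeBound.Negative.LoadBearing
import Summits.ABC.ABC.Theorems.IsogenyGlueCongruenceEllipticGluingPrimeBoundStubIsotypicDichotomy
import Literature.AlgebraicGeometry.Motives.AbelianVarietyProductDimProofs
import Literature.AlgebraicGeometry.Motives.AbelianVarietyIsogenyProofs
import Literature.AlgebraicGeometry.Motives.AbelianVarietyBaseChange
import Literature.AlgebraicGeometry.Motives.AbelianVarietyPoincareCompleteReducibility
import Literature.AlgebraicGeometry.Motives.AbelianVarietyTorsionPointsCountProofs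
import Literature.NumberTheory.EllipticCurves.RationalIsogenyDegreesProofs
import Literature.NumberTheory.EllipticCurves.OpenImage
import Literature.NumberTheory.DiophantineGeometry.AVIsogenyQuasiInverse
import Literature.NumberTheory.DiophantineGeometry.AVKernelHopf
import HarnessLib

/-!
# Crux `EllipticGluingPrimeBound`, line Sketch — stub `stub_dichotomyOfIrreducible`

Stub `stub_dichotomyOfIrreducible` of line `Sketch` (isotypic–Minkowski reduction, skeleton v9) of
crux U `Summit.ABC.ABC.Theses.IsogenyGlueCongruence.EllipticGluingPrimeBound` (item stmt-ABC-13919).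

**Statement.** Let `W/ℚ` be an elliptic curve with AV-model `E` (a `Γ_ℚ`-equivariant
`e : E(ℚ̄) ≃+ W(ℚ̄)`), `B/ℚ` an abelian variety and `ℓ` a prime at which the mod-`ℓ` Galois
representation of `W` is irreducible (`W.HasIrreducibleModPGaloisRep ℓ`: the only `Γ_ℚ`-stable
subgroups of `W[ℓ]` are `⊥` and `⊤`) and at which `(E, B)` is *glued*: some `E`-multiplier
`α ≫ β = n • 𝟙 E` with `n ≠ 0` exists, and `ℓ` divides every `E`-multiplier of `B`. Then EITHER
`(E, B₁)` is glued at `ℓ` for some `B₁/ℚ` with `dim B₁ ≤ dim B` all of whose non-zero geometric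
quotients receive a non-zero homomorphism from `E_ℚ̄` (`B₁` is zero or geometrically
`E`-isotypic), OR there is a geometrically `E`-free `A/ℚ` (`Hom_ℚ̄(E_ℚ̄, A_ℚ̄) = 0`) with
`dim A + 1 ≤ dim B` and `W[ℓ] ↪ A(ℚ̄)` `Γ_ℚ`-equivariantly.

This is the landed `stub_isotypicDichotomy` (module
`Summits.ABC.ABC.Theorems.IsogenyGlueCongruenceEllipticGluingPrimeBoundStubIsotypicDichotomy`) with
ONE change: Mazur's theorem (the named fact `mazur_isogeny_irreducible`) together with the threshold
`ℓ > 163` is replaced by the per-instance hypothesis `W.HasIrreducibleModPGaloisRep ℓ`, so that the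
line can feed in irreducibility from whichever source it has (a height threshold for non-CM curves,
the CM Cartan image for CM curves) without Mazur's theorem.

**Reduction (this file).** The two inputs are hypotheses, each a neighbouring stub of the line:
* `hS` — the geometrically-`E`-isotypic splitting over `ℚ` (= `stub_geomIsotypicSplitting`):
  `(i, j) : B₁ ⊞ B₂ → B` an isogeny with `i` a closed immersion, `B₁` zero or geometrically
  `E`-isotypic, `Hom_ℚ̄(E, B₂) = 0`, and every `α : E → B` factoring through `i`;
* `hB` — the Case B engine (= `stub_caseB`): from a multiplier of `(E, B₁)` prime to `ℓ`, the
  divisibility by `ℓ` of every `E`-multiplier of `B` and the irreducibility of `E[ℓ]`, a quotient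
  isogeny `h : B₂ → A` with `W[ℓ] ↪ A(ℚ̄)` equivariantly.

**Proof.** `dim E = 1` (`dim_eq_one_of_equiv`, from the model module), so `hS` applies. Case A
(`ℓ` divides every multiplier of `(E, B₁)`): take `B₁` itself, glued via the factorisation
`α = α₁ ≫ i` and `i ≫ β`; `dim B₁ ≤ dim B₁ + dim B₂ = dim B`. Case B (some multiplier of `(E, B₁)`
is prime to `ℓ`): the irreducibility of `W[ℓ]` is transported along `e` to `E[ℓ]`
(`geomTorsion_le_of_irreducible`) and `hB` gives `h : B₂ → A`; `A` is geometrically `E`-free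
because `B₂` is (isogeny invariance: compose with the base change of a quasi-inverse of `h` and
cancel the isogeny `[n]` of `E_ℚ̄`), and `dim A = dim B₂ = dim B - dim B₁ ≤ dim B - 1` because
`dim B₁ ≠ 0`: `α₁ ≫ (i ≫ β) = n • 𝟙 E` is a non-zero `E`-multiplier of `B₁` (the tree's
`EllipticGluingPrimeBound.Negative.dim_ne_zero_of_multiplier`, from
`Theorems/EllipticGluingPrimeBound/Negative/LoadBearing`).

Public helper: `geomTorsion_le_of_irreducible`. Reused from the model module (namespace
`Summit.ABC.ABC.Theorems.IsotypicMinkowski`): `map_mem_geomTorsion_iff`, `dim_eq_one_of_equiv`.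
The model's two private bookkeeping lemmas (isogeny invariance of geometric `E`-freeness,
`dim B = dim B₁ + dim B₂`) are re-proved here under primed private names. Deliberately NOT here:
no definitions, no proof of the two inputs, no cited fact — the statement is unconditional.
-/

noncomputable section

-- `Summit.<Summit>.<Problem>` is the mandated summit-side namespace (CONVENTIONS §2); for the
-- single-conjunct summit `ABC` the two coincide, so the duplicate `ABC.ABC` is deliberate.
set_option linter.dupNamespace false

namespace Summit.ABC.ABC.Theorems.IsotypicMinkowski

open CategoryTheory CategoryTheory.Limits AlgebraicGeometry
open Literature.AlgebraicGeometry.Motives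
open Summit.ABC.ABC.Theses.IsogenyGlueCongruence

/-! ### Irreducibility of `W[ℓ]` transported to `E[ℓ]` along `e` -/

/-- **A non-zero `Γ_ℚ`-stable subgroup of `E[ℓ]` is all of `E[ℓ]`** when the mod-`ℓ` Galois
representation of `W` is irreducible (`W.HasIrreducibleModPGaloisRep ℓ`: the only `Γ_ℚ`-stable
subgroups of `W[ℓ]` are `⊥` and `⊤`), transported along the equivariant isomorphism
`e : E(ℚ̄) ≃+ W(ℚ̄)`: the image `H' ≤ W[ℓ]` of `H` is `Γ_ℚ`-stable, it is `≠ ⊥` because `H ≠ ⊥`,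
hence `H' = ⊤`, i.e. `E[ℓ] ≤ H`. (The model module's `geomTorsion_le_of_stable` with Mazur's
theorem and `ℓ > 163` replaced by the per-instance irreducibility hypothesis.) -/
theorem geomTorsion_le_of_irreducible {W : WeierstrassCurve ℚ} {E : AbelianVariety.{0} ℚ} {ℓ : ℕ}
    (hirr : W.HasIrreducibleModPGaloisRep ℓ) (e : E.geomPoints ≃+ W.geomPoints)
    (he : ∀ (σ : Field.absoluteGaloisGroup ℚ) (P : E.geomPoints), e (σ • P) = σ • e P)
    (H : AddSubgroup E.geomPoints) (hH : H ≤ E.geomTorsion ℓ)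
    (hstab : ∀ (σ : Field.absoluteGaloisGroup ℚ) (P : E.geomPoints), P ∈ H → σ • P ∈ H)
    (hne : H ≠ ⊥) : E.geomTorsion ℓ ≤ H := by
  classical
  -- the transported subgroup of `W[ℓ]`
  let H' : AddSubgroup (W.geomTorsion ℓ) :=
    (H.map e.toAddMonoidHom).comap (W.geomTorsion ℓ).subtype
  have hH'stab : ∀ (σ : Field.absoluteGaloisGroup ℚ) (Q : W.geomTorsion ℓ),
      Q ∈ H' → σ • Q ∈ H' := by
    intro σ Q hQ
    simp only [H', AddSubgroup.mem_comap, AddSubgroup.coe_subtype, AddSubgroup.mem_map] at hQ ⊢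
    obtain ⟨P, hP, hPQ⟩ := hQ
    refine ⟨σ • P, hstab σ P hP, ?_⟩
    change e (σ • P) = ((σ • Q : W.geomTorsion ℓ) : W.geomPoints)
    rw [he, Literature.NumberTheory.EllipticCurves.AddSubgroup.torsionBy.coe_smul]
    exact congrArg (σ • ·) hPQ
  rcases hirr H' hH'stab with h | h
  · -- `H' = ⊥` contradicts `H ≠ ⊥`
    exfalso
    apply hne
    rw [eq_bot_iff]
    intro P hP
    have hPt : e P ∈ W.geomTorsion ℓ := (map_mem_geomTorsion_iff e ℓ P).2 (hH hP)
    have hmem : (⟨e P, hPt⟩ : W.geomTorsion ℓ) ∈ H' := by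
      simp only [H', AddSubgroup.mem_comap, AddSubgroup.coe_subtype, AddSubgroup.mem_map]
      exact ⟨P, hP, rfl⟩
    rw [h, AddSubgroup.mem_bot] at hmem
    have : e P = 0 := congrArg Subtype.val hmem
    rw [AddSubgroup.mem_bot]
    exact e.map_eq_zero_iff.1 this
  · intro P hP
    have hPt : e P ∈ W.geomTorsion ℓ := (map_mem_geomTorsion_iff e ℓ P).2 hP
    have hmem : (⟨e P, hPt⟩ : W.geomTorsion ℓ) ∈ H' := by rw [h]; trivial
    simp only [H', AddSubgroup.mem_comap, AddSubgroup.coe_subtype, AddSubgroup.mem_map] at hmem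
    obtain ⟨P', hP', hPP'⟩ := hmem
    rwa [← e.injective hPP']

/-! ### Two private bookkeeping lemmas for the splitting `B₁ ⊞ B₂ → B` -/

/-- Geometric `E`-freeness is an isogeny invariant: if `h : A → A'` is an isogeny and
`Hom_ℚ̄(E, A) = 0` then `Hom_ℚ̄(E, A') = 0`. Compose `f : E_ℚ̄ → A'_ℚ̄` with the base change of a
quasi-inverse `g` of `h` (`g ≫ h = [n]`, `n ≥ 1`): `f ≫ g_ℚ̄ = 0`, so `f ≫ [n] = 0`, i.e.
`[n]_{E_ℚ̄} ≫ f = 0`, and the isogeny `[n]_{E_ℚ̄}` cancels. (Re-proof of the model module's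
private lemma of the same name, unprimed.) -/
private theorem isGeomFree_of_isIsogeny' {E A A' : AbelianVariety.{0} ℚ} {h : A ⟶ A'}
    (hh : AbelianVariety.IsIsogeny h)
    (hfree : ∀ f : E.baseChange (AlgebraicClosure ℚ) ⟶ A.baseChange (AlgebraicClosure ℚ), f = 0) :
    ∀ f : E.baseChange (AlgebraicClosure ℚ) ⟶ A'.baseChange (AlgebraicClosure ℚ), f = 0 := by
  intro f
  obtain ⟨g, n, hn, -, hgh⟩ := AbelianVariety.IsIsogeny.exists_nsmul_inverse_holds hh
  set L := AlgebraicClosure ℚ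
  have h1 : f ≫ AbelianVariety.Hom.baseChange L g = 0 := hfree _
  have h2 : f ≫ AbelianVariety.Hom.baseChange L (g ≫ h) = 0 := by
    rw [AbelianVariety.Hom.baseChange_comp, ← Category.assoc, h1, zero_comp]
  rw [hgh, show (n • 𝟙 A' : A' ⟶ A') = (n : ℤ) • 𝟙 A' from (natCast_zsmul _ _).symm,
    AbelianVariety.baseChange_zsmul_id, Preadditive.comp_zsmul, Category.comp_id,
    ← Category.id_comp f, ← Preadditive.zsmul_comp] at h2
  have hn' : ((n : ℤ) : L) ≠ 0 := by
    have : (n : L) ≠ 0 := by exact_mod_cast hn.ne'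
    exact_mod_cast this
  exact (AbelianVariety.isIsogeny_zsmul_id_of_cast_ne_zero (A := E.baseChange L) (n : ℤ)
    hn').cancel_left (h2.trans comp_zero.symm)

/-- `dim B = dim B₁ + dim B₂` when `(i, j) : B₁ ⊞ B₂ → B` is an isogeny (isogenous abelian
varieties have equal dimension; `B₁ ⊞ B₂ ≅ B₁ × B₂` and `dim (B₁ × B₂) = dim B₁ + dim B₂`).
(Re-proof of the model module's private lemma of the same name, unprimed.) -/
private theorem dim_eq_add_of_isIsogeny_desc' {B B₁ B₂ : AbelianVariety.{0} ℚ} (i : B₁ ⟶ B)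
    (j : B₂ ⟶ B) (hσ : AbelianVariety.IsIsogeny (biprod.desc i j)) :
    B.dim = B₁.dim + B₂.dim := by
  have h1 : (B₁ ⊞ B₂).dim = B.dim := AbelianVariety.dim_eq_of_isIsogenous_holds ⟨_, hσ⟩
  have h2 : (B₁ ⊞ B₂).dim = (B₁.prod B₂).dim :=
    AbelianVariety.dim_eq_of_isIsogenous_holds
      ⟨_, AbelianVariety.isIsogeny_hom_of_iso (AbelianVariety.biprodIsoProd B₁ B₂)⟩
  rw [← h1, h2, AbelianVariety.dim_prod]

/-! ### The dichotomy, given irreducibility of `W[ℓ]` -/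

/-- **Stub `stub_dichotomyOfIrreducible` (NEW in skeleton v9) of line Sketch**: the dichotomy of
the landed `stub_isotypicDichotomy` with Mazur's theorem and `ℓ > 163` replaced by the per-instance
hypothesis `W.HasIrreducibleModPGaloisRep ℓ`. From the geometrically-`E`-isotypic splitting over
`ℚ` (`hS`) and the Case B engine (`hB`): a pair `(E, B)` glued at a prime `ℓ` at which `W[ℓ]` is an
irreducible `Γ_ℚ`-module (a non-zero `E`-multiplier exists and `ℓ` divides every `E`-multiplier)
either restricts to a glued pair `(E, B₁)` with `dim B₁ ≤ dim B` and `B₁`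
zero-or-geometrically-`E`-isotypic (Case A: `ℓ` divides every multiplier of `(E, B₁)`; glue via
`α = α₁ ≫ i` and `i ≫ β`), or yields a geometrically `E`-free `A/ℚ` with `dim A + 1 ≤ dim B` and
`W[ℓ] ↪ A(ℚ̄)` equivariantly (Case B: a multiplier of `(E, B₁)` prime to `ℓ`; `hB` with the
irreducibility of `E[ℓ]` from `geomTorsion_le_of_irreducible`; `A` is `E`-free by isogeny
invariance and `dim A = dim B₂ = dim B - dim B₁ ≤ dim B - 1`, the non-zero multiplier
`α₁ ≫ (i ≫ β) = [n]` forcing `dim B₁ ≠ 0`). -/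
theorem stub_dichotomyOfIrreducible
    (hS : ∀ (E B : AbelianVariety.{0} ℚ), E.dim = 1 →
      ∃ (B₁ B₂ : AbelianVariety.{0} ℚ) (i : B₁ ⟶ B) (j : B₂ ⟶ B),
        IsClosedImmersion (AbelianVariety.Hom.toSchemeHom i) ∧
        AbelianVariety.IsIsogeny (biprod.desc i j) ∧
        (∀ (C : AbelianVariety.{0} (AlgebraicClosure ℚ))
            (g : B₁.baseChange (AlgebraicClosure ℚ) ⟶ C),
            Surjective (AbelianVariety.Hom.toSchemeHom g) → C.dim ≠ 0 →
            ∃ f : E.baseChange (AlgebraicClosure ℚ) ⟶ C, f ≠ 0) ∧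
        (∀ f : E.baseChange (AlgebraicClosure ℚ) ⟶ B₂.baseChange (AlgebraicClosure ℚ), f = 0) ∧
        ∀ α : E ⟶ B, ∃ α₁ : E ⟶ B₁, α₁ ≫ i = α)
    (hB : ∀ (W : WeierstrassCurve ℚ) [W.IsElliptic] (E B B₁ B₂ : AbelianVariety.{0} ℚ)
      (e : E.geomPoints ≃+ W.geomPoints),
      (∀ (σ : Field.absoluteGaloisGroup ℚ) (P : E.geomPoints), e (σ • P) = σ • e P) →
      ∀ ℓ : ℕ, ℓ.Prime →
      (∀ V : AddSubgroup E.geomPoints, V ≤ E.geomTorsion ℓ →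
        (∀ (σ : Field.absoluteGaloisGroup ℚ) (P : E.geomPoints), P ∈ V → σ • P ∈ V) → V ≠ ⊥ →
        E.geomTorsion ℓ ≤ V) →
      (∀ (α : E ⟶ B) (β : B ⟶ E) (n : ℤ), α ≫ β = n • 𝟙 E → (ℓ : ℤ) ∣ n) →
      ∀ (i : B₁ ⟶ B) (j : B₂ ⟶ B), IsClosedImmersion (AbelianVariety.Hom.toSchemeHom i) →
      AbelianVariety.IsIsogeny (biprod.desc i j) →
      ∀ (α₀ : E ⟶ B₁) (β₀ : B₁ ⟶ E) (m : ℤ), α₀ ≫ β₀ = m • 𝟙 E → ¬ (ℓ : ℤ) ∣ m →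
      ∃ (A : AbelianVariety.{0} ℚ) (h : B₂ ⟶ A), AbelianVariety.IsIsogeny h ∧
        ∃ ι : W.geomTorsion ℓ →+ A.geomPoints, Function.Injective ι ∧
          ∀ (σ : Field.absoluteGaloisGroup ℚ) (P : W.geomTorsion ℓ), ι (σ • P) = σ • ι P) :
    ∀ (W : WeierstrassCurve ℚ) [W.IsElliptic] (E B : AbelianVariety.{0} ℚ)
      (e : E.geomPoints ≃+ W.geomPoints),
      (∀ (σ : Field.absoluteGaloisGroup ℚ) (P : E.geomPoints), e (σ • P) = σ • e P) →
      ∀ ℓ : ℕ, ℓ.Prime → W.HasIrreducibleModPGaloisRep ℓ →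
      (∃ (α : E ⟶ B) (β : B ⟶ E) (n : ℤ), n ≠ 0 ∧ α ≫ β = n • 𝟙 E) →
      (∀ (α : E ⟶ B) (β : B ⟶ E) (n : ℤ), α ≫ β = n • 𝟙 E → (ℓ : ℤ) ∣ n) →
      (∃ B₁ : AbelianVariety.{0} ℚ, B₁.dim ≤ B.dim ∧
        (∀ (C : AbelianVariety.{0} (AlgebraicClosure ℚ))
            (g : B₁.baseChange (AlgebraicClosure ℚ) ⟶ C),
            Surjective (AbelianVariety.Hom.toSchemeHom g) → C.dim ≠ 0 →
            ∃ f : E.baseChange (AlgebraicClosure ℚ) ⟶ C, f ≠ 0) ∧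
        (∃ (α : E ⟶ B₁) (β : B₁ ⟶ E) (n : ℤ), n ≠ 0 ∧ α ≫ β = n • 𝟙 E) ∧
        (∀ (α : E ⟶ B₁) (β : B₁ ⟶ E) (n : ℤ), α ≫ β = n • 𝟙 E → (ℓ : ℤ) ∣ n)) ∨
      (∃ A : AbelianVariety.{0} ℚ, A.dim + 1 ≤ B.dim ∧
        (∀ f : E.baseChange (AlgebraicClosure ℚ) ⟶ A.baseChange (AlgebraicClosure ℚ), f = 0) ∧
        ∃ ι : W.geomTorsion ℓ →+ A.geomPoints, Function.Injective ι ∧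
          ∀ (σ : Field.absoluteGaloisGroup ℚ) (P : W.geomTorsion ℓ), ι (σ • P) = σ • ι P) := by
  intro W _ E B e he ℓ hℓ hirr hex hall
  obtain ⟨α, β, n, hn, hαβ⟩ := hex
  obtain ⟨B₁, B₂, i, j, hi, hσ, hiso, hfree, hfac⟩ := hS E B (dim_eq_one_of_equiv e)
  obtain ⟨α₁, hα₁⟩ := hfac α
  have hdim : B.dim = B₁.dim + B₂.dim := dim_eq_add_of_isIsogeny_desc' i j hσ
  -- the non-zero `E`-multiplier `α₁ ≫ (i ≫ β) = n • 𝟙 E` of `B₁`; in particular `dim B₁ ≠ 0`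
  have hmult : α₁ ≫ (i ≫ β) = n • 𝟙 E := by rw [← Category.assoc, hα₁, hαβ]
  have hB₁ : B₁.dim ≠ 0 :=
    Summit.ABC.ABC.Theorems.EllipticGluingPrimeBound.Negative.dim_ne_zero_of_multiplier e
      ⟨α₁, i ≫ β, n, hn, hmult⟩
  by_cases hA : ∀ (α' : E ⟶ B₁) (β' : B₁ ⟶ E) (m : ℤ), α' ≫ β' = m • 𝟙 E → (ℓ : ℤ) ∣ m
  · -- Case A: the zero-or-isotypic part `B₁` is itself glued at `ℓ`
    exact Or.inl ⟨B₁, by omega, hiso, ⟨α₁, i ≫ β, n, hn, hmult⟩, hA⟩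
  · -- Case B: a multiplier of `(E, B₁)` prime to `ℓ`; the Case B engine on the free complement
    push Not at hA
    obtain ⟨α₀, β₀, m, hm, hndvd⟩ := hA
    obtain ⟨A, h, hh, hemb⟩ := hB W E B B₁ B₂ e he ℓ hℓ
      (geomTorsion_le_of_irreducible hirr e he) hall i j hi hσ α₀ β₀ m hm hndvd
    refine Or.inr ⟨A, ?_, isGeomFree_of_isIsogeny' hh hfree, hemb⟩
    have hA₂ : B₂.dim = A.dim := AbelianVariety.dim_eq_of_isIsogenous_holds ⟨h, hh⟩
    omega

end Summit.ABC.ABC.Theorems.IsotypicMinkowski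

end
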